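import Summits.QuantumAdvantage.QuantumAdvantage.Theorems.NearExactIsExact.Negative.OneSidedTaylor
import Summits.QuantumAdvantage.QuantumAdvantage.Theorems.NearExactIsExact.Negative.UntwistedSection

/-!
# `NearExactIsExact` (stmt-QuantumAdvantage-14043) — negative lemma THEOREM OZ (gen 42):
  the whole `A = 0` inversion-affine stratum over a quadratic base with a constant-derivative
  direction is EMPTY — one-sided, census-free, for every number `r` of fibre bits

**Context.** The last Maiorana–McFarland habitat of `NearExactIsExact` (a cubic pair with
`15/16 < Φ < 1` needs `Φ = 31/32` and a biquadratic permutation whose residual `c₁ ⊕ c₂∘π` is the flat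
indicator `1_{u = 0}`, DISPROOF.md §10–§24 of the b2b cell) was cut down, generation by generation, to
configurations `π(u, w) = (γ u, B(u) ⊕ act_u w)` over a 6-bit base; the inversion-affine frames with
trivial linear part (`act = id`, "pure translation by a quadratic `B`": cube Z, the E-cubes, THEOREM TT,
the 26 column pencils) were closed by finite censuses (kit jobs, §46–§47) and by THEOREM-CANDIDATE P.
THEOREM ZP / D4 (`Negative.ReflectedPairIdentity`, `Negative.SectionDerivativeCube`) turned the `r + 1`
residual identities (zero section `h0`; affine section `tsec_a` through `B u ⊕ e_a`, `hsec`) into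
kernel-checked necessary conditions. This file shows they are in fact CONTRADICTORY.

**THEOREM OZ** (`oneSided_frame_empty`). Let `γ : 𝔽₂⁶ → 𝔽₂⁶` have coordinate functions of degree
`≤ 2` and a direction `i₀` with `γ(u ⊕ e_{i₀}) ⊕ γ(u) = δ` constant (`hγδ`; cube Z: `γ = (ū, u₅ ⊕ g(ū))`,
`δ = e₅`, see `oneSided_cubeZ_empty`; `γ = id` for TT / pencils), `B : 𝔽₂⁶ → 𝔽₂^r` quadratic, `c₁, c₂`
cubic on `6 + r` bits, `t_a : 𝔽₂⁶ → 𝔽₂^r` affine. Then `h0 : c₁(u,0) ⊕ c₂(γu, Bu) = [u = 0]` and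
`hsec : c₁(u, t_a u) ⊕ c₂(γu, Bu ⊕ e_a) = [u = 0]` (all `a`, `u`) cannot both hold. No bijectivity, no
two-sidedness, no computation: the stratum is empty for every `r`, and so is its one-sided relaxation.

**Proof.** (i) `Σ_u c₂(γu,Bu) = Σ_u [u=0] + Σ_u c₁(u,0) = 1` (a cubic on 6 bits has even weight).
(ii) For each `a`, `w_a(u) := B_a(u) ⊕ B_a(u|u_{i₀}←0)` has degree `≤ 2` and the section derivative
`D_a(u) := c₂(γu,Bu) ⊕ c₂(γu,Bu ⊕ e_a) = c₁(u,0) ⊕ c₁(u,t_a u)` is cubic (`sectionDerivative_deg`), so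
`Σ_u w_a D_a = 0` (degree `≤ 5`, Ax). (iii) The IDENTITY `Σ_u c₂(γu,Bu) = Σ_a Σ_u w_a D_a` holds
unconditionally (`key_identity`): Shannon-split `φ := c₂(γu,Bu) + Σ_a w_a D_a` at `i₀`
(`sum_shannon`: `Σ_u φ = Σ_u u_{i₀}·(φ(u⁺) + φ(u⁻))`); with `P^± := (γ u^±, B u⁺)`, `P⁺ = P⁻ ⊕ (δ,0)`,
`β := B u⁺ ⊕ B u⁻` (affine), the fibre Taylor expansion of the cubic `c₂` around `B u⁺`
(`expand` of THEOREM A applied to the translate of `c₂`, `coefC_shift`) gives (`pointwise_taylor`)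
`φ(u⁺) + φ(u⁻) = [c₂(P⁻) + c₂(P⁺)] + Σ_a β_a·[Δ_a c₂(P⁻) + Δ_a c₂(P⁺)] + Σ_{2≤|S|≤3} β_S·Δ_S c₂(P⁻)`
(`Δ_S = dsum c₂ S`, degree `≤ 3 − |S|`), three families of `u`-degree `≤ 4, 3, 4` (coordinates of `P⁻`
are quadratic, `P⁺ ⊕ P⁻` is constant); times `u_{i₀}`: degree `≤ 5 < 6`, so every term has even weight
(`taylor_sum_zero`). Hence `1 = 0`. The identity is a genuine top-degree identity: numerically it fails
for quartic `c₂`, cubic `B`, cubic `γ`, or a non-constant `∂_{i₀}γ` (DISPROOF.md §48.9).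

HONEST FRAMING: the value here is a THEOREM (a kernel-checked negative lemma that empties one infinite,
previously census-bound sub-family of the last Maiorana–McFarland habitat of `NearExactIsExact`, and
re-proves the cube-Z / TT / pencil censuses without computation), NOT summit progress; frames with a
non-trivial linear fibre action (`A ≠ 0`), non-affine sections and bases without a constant-derivative
direction are untouched, as are the crux and the summit.
-/
set_option linter.dupNamespace false -- D-0017: single-problem summit ⇒ `QuantumAdvantage.QuantumAdvantage` by design

namespace Summit.QuantumAdvantage.QuantumAdvantage.Theorems.NearExactIsExact.Negative.OneSidedFrame

open Finset
open Literature.Computability.QuantumComplexity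
open Literature.Computability.QuantumComplexity.BuzetChailloux (bxor)
open Summit.QuantumAdvantage.QuantumAdvantage.Theorems.CubicForrelation.NearExactIsExact
  (fc_isDegLeFun_comp fc_deg_bxor stub_derivDegree te_isDegLeFun_band)
open Summit.QuantumAdvantage.QuantumAdvantage.Theorems.NearExactIsExact.Negative.SkewProductCore
open Summit.QuantumAdvantage.QuantumAdvantage.Theorems.NearExactIsExact.Negative.SkewProductResidual
open Summit.QuantumAdvantage.QuantumAdvantage.Theorems.NearExactIsExact.Negative.UntwistedSection
  (sum_ind_delta)
open Summit.QuantumAdvantage.QuantumAdvantage.Theorems.NearExactIsExact.Negative.OneSidedTaylor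

variable {r : ℕ}

/-- `x + 1 = 0 → x = 1` in `𝔽₂`. [folklore] -/
theorem eq_one_of_add_one : ∀ x : ZMod 2, x + 1 = 0 → x = 1 := by decide

/-! ### THEOREM OZ -/

/-- **The key identity.** For cubic `c₂`, quadratic `B`, a quadratic base map `γ` with
`γ(u⁺) = γ(u⁻) ⊕ δ` (constant derivative in the direction `e_{i₀}`):
`Σ_u [ c₂(γu, Bu) + Σ_a (B_a(u) ⊕ B_a(u⁻))·(c₂(γu,Bu) ⊕ c₂(γu,Bu⊕e_a)) ] = 0` in `𝔽₂`,
i.e. `Σ_u c₂(γu,Bu) = Σ_a Σ_u w_a·D_a` — unconditionally (no residual hypothesis). [folklore] -/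
theorem key_identity (i₀ : Fin 6) (δ : Fin 6 → Bool) (γ : (Fin 6 → Bool) → (Fin 6 → Bool))
    (hγq : ∀ i, IsDegLeFun 2 (fun u => γ u i))
    (hγδ : ∀ u, γ (Function.update u i₀ true) = bxor (γ (Function.update u i₀ false)) δ)
    (B : Fin r → (Fin 6 → Bool) → Bool) (hB : ∀ k, IsDegLeFun 2 (B k))
    (c₂ : (Fin (6 + r) → Bool) → Bool) (h₂ : IsDegLeFun 3 c₂) :
    ∑ u : Fin 6 → Bool, (ind (c₂ (Fin.append (γ u) (fun k => B k u))) +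
      ∑ a, ind ((B a u ^^ B a (Function.update u i₀ false)) &&
        (c₂ (Fin.append (γ u) (fun k => B k u)) ^^
          c₂ (Fin.append (γ u) (fun k => decide (k = a) ^^ B k u))))) = 0 := by
  -- the base point `P⁻(u) = (γ u⁻, B u⁺)` has quadratic coordinates
  have hPm : ∀ j, IsDegLeFun 2 (fun u : Fin 6 → Bool =>
      Fin.append (γ (Function.update u i₀ false)) (fun k => B k (Function.update u i₀ true)) j) := by
    intro j
    induction j using Fin.addCases with
    | left i =>
      have e : (fun u : Fin 6 → Bool => Fin.append (γ (Function.update u i₀ false))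
          (fun k => B k (Function.update u i₀ true)) (Fin.castAdd r i)) =
          fun u => γ (Function.update u i₀ false) i :=
        funext fun u => Fin.append_left _ _ i
      rw [e]
      exact fc_isDegLeFun_comp (hγq i) (fun u => Function.update u i₀ false)
        (update_coord_deg i₀ false) (by norm_num)
    | right k =>
      have e : (fun u : Fin 6 → Bool => Fin.append (γ (Function.update u i₀ false))
          (fun k => B k (Function.update u i₀ true)) (Fin.natAdd 6 k)) =
          fun u => B k (Function.update u i₀ true) :=
        funext fun u => Fin.append_right _ _ k
      rw [e]
      exact fc_isDegLeFun_comp (hB k) (fun u => Function.update u i₀ true)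
        (update_coord_deg i₀ true) (by norm_num)
  -- `β_a = B_a(u⁺) ⊕ B_a(u⁻)` is affine (derivative of a quadratic, pulled back along `u ↦ u⁺`)
  have hβ : ∀ a, IsDegLeFun 1 (fun u : Fin 6 → Bool =>
      B a (Function.update u i₀ true) ^^ B a (Function.update u i₀ false)) := by
    intro a
    have hD : IsDegLeFun 1 (fun v => B a v ^^ B a (bxor v (fun i => decide (i = i₀)))) :=
      stub_derivDegree 6 1 (B a) _ (hB a)
    have e : (fun u : Fin 6 → Bool => B a (Function.update u i₀ true) ^^
        B a (Function.update u i₀ false)) = fun u => B a (Function.update u i₀ true) ^^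
          B a (bxor (Function.update u i₀ true) (fun i => decide (i = i₀))) := by
      funext u; rw [update_true_bxor]
    rw [e]
    exact fc_isDegLeFun_comp hD (fun u => Function.update u i₀ true) (update_coord_deg i₀ true)
      (by norm_num)
  -- `P⁺ = P⁻ ⊕ (δ, 0)`
  have hP : ∀ u : Fin 6 → Bool, bxor (Fin.append (γ (Function.update u i₀ false))
      (fun k => B k (Function.update u i₀ true))) (Fin.append δ (fun _ => false)) =
      Fin.append (γ (Function.update u i₀ true)) (fun k => B k (Function.update u i₀ true)) := by
    intro u; rw [bxor_append_blocks, ← hγδ u, bxor_zero_right]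
  rw [sum_shannon _ i₀]
  refine Eq.trans (sum_congr rfl fun u _ => ?_)
    (taylor_sum_zero c₂ h₂ i₀ (Fin.append δ (fun _ => false))
      (fun u => Fin.append (γ (Function.update u i₀ false)) (fun k => B k (Function.update u i₀ true)))
      hPm (fun a u => B a (Function.update u i₀ true) ^^ B a (Function.update u i₀ false)) hβ)
  simp only [Function.update_idem, Bool.xor_self, Bool.false_and, ind_false, sum_const_zero, add_zero]
  rw [hP u, pointwise_taylor c₂ h₂ (γ (Function.update u i₀ true)) (γ (Function.update u i₀ false))
    (fun k => B k (Function.update u i₀ true)) (fun k => B k (Function.update u i₀ false))]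

/-- **THEOREM OZ (gen 42).** For every `r`: no quadratic base map `γ` of `𝔽₂⁶` with a constant
derivative direction (`γ(u⁺) = γ(u⁻) ⊕ δ`), quadratic fibre translation `B`, cubic `c₁, c₂` and AFFINE
sections `t_a` satisfy the zero-section residual identity `h0` together with the `r` section identities
`hsec` — the `A = 0` inversion-affine stratum (and its one-sided relaxation) is EMPTY. [folklore] -/
theorem oneSided_frame_empty (i₀ : Fin 6) (δ : Fin 6 → Bool) (γ : (Fin 6 → Bool) → (Fin 6 → Bool))
    (hγq : ∀ i, IsDegLeFun 2 (fun u => γ u i))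
    (hγδ : ∀ u, γ (Function.update u i₀ true) = bxor (γ (Function.update u i₀ false)) δ)
    (B : Fin r → (Fin 6 → Bool) → Bool) (hB : ∀ k, IsDegLeFun 2 (B k))
    (c₁ c₂ : (Fin (6 + r) → Bool) → Bool) (h₁ : IsDegLeFun 3 c₁) (h₂ : IsDegLeFun 3 c₂)
    (t : Fin r → (Fin 6 → Bool) → Fin r → Bool) (ht : ∀ a k, IsDegLeFun 1 (fun u => t a u k))
    (h0 : ∀ u, (c₁ (Fin.append u (fun _ => false)) ^^ c₂ (Fin.append (γ u) (fun k => B k u))) =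
      decide (∀ i, u i = false))
    (hsec : ∀ a u, (c₁ (Fin.append u (t a u)) ^^
      c₂ (Fin.append (γ u) (fun k => decide (k = a) ^^ B k u))) = decide (∀ i, u i = false)) :
    False := by
  -- (i) the zero-section term has odd weight
  have h1 : ∑ u : Fin 6 → Bool, ind (c₂ (Fin.append (γ u) (fun k => B k u))) = 1 := by
    have hc0 : IsDegLeFun 3 (fun u : Fin 6 → Bool => c₁ (Fin.append u (fun _ => false))) :=
      fc_isDegLeFun_comp h₁ (emb r) (emb_coord_deg r) (by norm_num)
    have hz := sum_ind_eq_zero_of_deg_five (hc0.mono (by norm_num))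
    have aux : ∀ p q d : Bool, (p ^^ q) = d → (q ^^ d) = p := by decide
    have hpt : ∀ u : Fin 6 → Bool, ind (c₁ (Fin.append u (fun _ => false))) =
        ind (c₂ (Fin.append (γ u) (fun k => B k u))) + ind (decide (∀ i, u i = false)) := fun u => by
      rw [← ind_xor, aux _ _ _ (h0 u)]
    rw [sum_congr rfl (fun u _ => hpt u), sum_add_distrib, sum_ind_delta] at hz
    exact eq_one_of_add_one _ hz
  -- (ii) each weighted section derivative has even weight
  have h2 : ∀ a, ∑ u : Fin 6 → Bool, ind ((B a u ^^ B a (Function.update u i₀ false)) &&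
      (c₂ (Fin.append (γ u) (fun k => B k u)) ^^
        c₂ (Fin.append (γ u) (fun k => decide (k = a) ^^ B k u)))) = 0 := by
    intro a
    have hw : IsDegLeFun 2 (fun u : Fin 6 → Bool => B a u ^^ B a (Function.update u i₀ false)) :=
      fc_deg_bxor (hB a) (fc_isDegLeFun_comp (hB a) (fun u => Function.update u i₀ false)
        (update_coord_deg i₀ false) (by norm_num))
    -- the section derivative `D_a = c₁(u,0) ⊕ c₁(u, t_a u)` is cubic (cf. `sectionDerivative_deg`)
    have aux2 : ∀ p q p' q' d : Bool, (p ^^ q) = d → (p' ^^ q') = d → (q ^^ q') = (p ^^ p') := by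
      decide
    have hsc : ∀ j : Fin (6 + r), IsDegLeFun 1 (fun u : Fin 6 → Bool => Fin.append u (t a u) j) := by
      intro j
      induction j using Fin.addCases with
      | left i =>
        have e : (fun u : Fin 6 → Bool => Fin.append u (t a u) (Fin.castAdd r i)) = fun u => u i :=
          funext fun u => Fin.append_left u _ i
        rw [e]; exact isDegLeFun_apply i le_rfl
      | right k =>
        have e : (fun u : Fin 6 → Bool => Fin.append u (t a u) (Fin.natAdd 6 k)) = fun u => t a u k :=
          funext fun u => Fin.append_right u _ k
        rw [e]; exact ht a k
    have hD : IsDegLeFun 3 (fun u : Fin 6 → Bool => c₂ (Fin.append (γ u) (fun k => B k u)) ^^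
        c₂ (Fin.append (γ u) (fun k => decide (k = a) ^^ B k u))) := by
      have e : (fun u : Fin 6 → Bool => c₂ (Fin.append (γ u) (fun k => B k u)) ^^
          c₂ (Fin.append (γ u) (fun k => decide (k = a) ^^ B k u))) =
          fun u => c₁ (Fin.append u (fun _ => false)) ^^ c₁ (Fin.append u (t a u)) :=
        funext fun u => aux2 _ _ _ _ _ (h0 u) (hsec a u)
      rw [e]
      exact fc_deg_bxor (fc_isDegLeFun_comp h₁ (emb r) (emb_coord_deg r) (by norm_num))
        (fc_isDegLeFun_comp h₁ (fun u => Fin.append u (t a u)) hsc (by norm_num))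
    have h5 : IsDegLeFun 5 (fun u : Fin 6 → Bool => (B a u ^^ B a (Function.update u i₀ false)) &&
        (c₂ (Fin.append (γ u) (fun k => B k u)) ^^
          c₂ (Fin.append (γ u) (fun k => decide (k = a) ^^ B k u)))) :=
      te_isDegLeFun_band hw hD
    exact sum_ind_eq_zero_of_deg_five h5
  -- (iii) the key identity says (i) + Σ_a (ii) = 0
  have h3 := key_identity i₀ δ γ hγq hγδ B hB c₂ h₂
  rw [sum_add_distrib, h1, sum_comm, sum_eq_zero (fun a _ => h2 a), add_zero] at h3
  exact one_ne_zero h3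

/-- **THEOREM OZ for cube Z.** The census normal form: base `γ(u) = u` with `u_{i₀} ← u_{i₀} ⊕ g(u)`,
`g` quadratic and independent of `u_{i₀}`; `B` quadratic; cubic `c₁, c₂`; affine sections. EMPTY for
every `r` — THEOREM-CANDIDATE P, the cube-Z census, CONJECTURE OS5 at `A = 0`, THEOREM TT ∩ {σ
quadratic} (`g = 0`) and the column pencils, one-sidedly and without computation. [folklore] -/
theorem oneSided_cubeZ_empty (i₀ : Fin 6) (g : (Fin 6 → Bool) → Bool) (hg : IsDegLeFun 2 g)
    (hg0 : ∀ u b, g (Function.update u i₀ b) = g u)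
    (B : Fin r → (Fin 6 → Bool) → Bool) (hB : ∀ k, IsDegLeFun 2 (B k))
    (c₁ c₂ : (Fin (6 + r) → Bool) → Bool) (h₁ : IsDegLeFun 3 c₁) (h₂ : IsDegLeFun 3 c₂)
    (t : Fin r → (Fin 6 → Bool) → Fin r → Bool) (ht : ∀ a k, IsDegLeFun 1 (fun u => t a u k))
    (h0 : ∀ u, (c₁ (Fin.append u (fun _ => false)) ^^
      c₂ (Fin.append (Function.update u i₀ (u i₀ ^^ g u)) (fun k => B k u))) =
        decide (∀ i, u i = false))
    (hsec : ∀ a u, (c₁ (Fin.append u (t a u)) ^^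
      c₂ (Fin.append (Function.update u i₀ (u i₀ ^^ g u)) (fun k => decide (k = a) ^^ B k u))) =
        decide (∀ i, u i = false)) :
    False := by
  refine oneSided_frame_empty i₀ (fun i => decide (i = i₀))
    (fun u => Function.update u i₀ (u i₀ ^^ g u)) ?_ ?_ B hB c₁ c₂ h₁ h₂ t ht h0 hsec
  · intro i
    by_cases hi : i = i₀
    · subst hi
      have e : (fun u : Fin 6 → Bool => Function.update u i (u i ^^ g u) i) = fun u => u i ^^ g u :=
        funext fun u => Function.update_self i _ u
      rw [e]
      exact fc_deg_bxor (isDegLeFun_apply i (by norm_num)) hg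
    · have e : (fun u : Fin 6 → Bool => Function.update u i₀ (u i₀ ^^ g u) i) = fun u => u i :=
        funext fun u => Function.update_of_ne hi _ u
      rw [e]
      exact isDegLeFun_apply i (by norm_num)
  · intro u
    funext i
    rw [hg0, hg0]
    by_cases hi : i = i₀
    · subst hi; simp [bxor]
    · simp [bxor, hi]

end Summit.QuantumAdvantage.QuantumAdvantage.Theorems.NearExactIsExact.Negative.OneSidedFrame
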